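import Mathlib
import HarnessLib

/-!
# Kashiwara–Vergne (1978), Ch. III §5 "Pluriharmonic Polynomials" — the explicit polynomial model
# for `k = 1` (the pair `U(p,q) × U(1)`): `Δ_{ij}`, `𝔥`, `ℂ[xᵗy]`, the `GL(1)`-twist of (5.2),
# Lemma (5.3) and Corollary (5.4), with kernel proofs

Companion of `Literature.RepresentationTheory.KashiwaraVergne1978.HarmonicParameters` /
`….HarmonicRepresentationUpq` (which TYPE Ch. III Thm (6.3)/(7.2) at dictionary level, nothing
asserted).  This file is the EXPLICIT MODEL the dictionary talks about, in the case `k = 1`: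
polynomials on `X = M(p,1;ℂ) × M(q,1;ℂ) = ℂ^p × ℂ^q`, written `MvPolynomial (ιx ⊕ ιy) K` over index
types `ιx` (the `x_i`, `|ιx| = p`) and `ιy` (the `y_j`, `|ιy| = q`) and any field `K`
(the source has `K = ℂ`).  Everything below is a DEFINITION transcribing a printed formula, or a
THEOREM proved here; there is no named fact and no hypothesis.

Source: M. Kashiwara, M. Vergne, *On the Segal–Shale–Weil representations and harmonic
polynomials*, Invent. Math. **44** (1978) 1–47 [KashiwaraVergne1978], Ch. III §5, read on the GDZ
page images of pp. 41–42 (Göttinger Digitalisierungszentrum PPN356556735_0044).  Verbatim: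

* (5.1) p. 41: "We consider the system of differential equations `(Δ_{ij} f)(x, y) = 0` for
  `1 ≤ i ≤ p, 1 ≤ j ≤ q` where `Δ_{i,j} = Σ_{ν=1}^{k} ∂²/∂x_{iν}∂y_{jν}`; `x ∈ M(p,k;ℂ)`,
  `y ∈ M(q,k;ℂ)`.  We shall call a solution of this system pluriharmonic. We denote by `𝔥` the space
  of all pluriharmonic polynomials on `M(p,k;ℂ) × M(q,k;ℂ)`.  The group `GL(p,ℂ) × GL(q,ℂ) × GL(k,ℂ)`
  acts on `M(p,k;ℂ) × M(q,k;ℂ)` by `(g₁, g₂, c)·(x, y) → (g₁xc⁻¹, ᵗg₂⁻¹yᵗc)`.  The system (5.1) is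
  invariant by this action; so `𝔥` is a representation space of `GL(p,ℂ) × GL(q,ℂ) × GL(k,ℂ)`."
* (5.2) pp. 41–42: "Let us denote by `X` the variety `M(p,k;ℂ) × M(q,k;ℂ)` and by `ℂ[X]` the space
  of all polynomials on `X`. We note by `ℂ[xᵗy]` the subspace of `ℂ[X]` generated by `(xᵗy)_{i,j}`;
  `1 ≤ i ≤ p, 1 ≤ j ≤ q`. We introduce, for `λ` an irreducible holomorphic representation of
  `GL(k;ℂ)`, `ℂ[X](λ)` (resp. `𝔥(λ)`) the space of all `V_λ`-valued polynomials (resp. pluriharmonic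
  polynomials) such that `P(xc, yᵗc⁻¹) = λ(c)⁻¹P(x, y)`.  We have `𝔥 = ⊕_{λ ∈ GL(k,ℂ)^} 𝔥(λ) ⊗ V_{λ'}`."
* (5.3) p. 42: "**Lemma.** `ℂ[X] = ℂ[xᵗy] 𝔥`."  (5.4) "**Corollary.** `ℂ[X](λ) = ℂ[xᵗy] 𝔥(λ)`."
* (5.5) p. 42: "We shall denote by `Σ` the subset of `λ ∈ U(k)^` such that `𝔥(λ) ≠ 0`. … For `λ ∈ Σ`
  we denote by `τ(λ)` the representation of `GL(p,ℂ) × GL(q,ℂ)` on `𝔥(λ)` given by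
  `((g₁, g₂)·P)(x, y) = P(g₁⁻¹x, ᵗg₂y)`."  (5.6) "**Proposition.** `τ = τ(λ)` is an irreducible
  representation of `GL(p,ℂ) × GL(q,ℂ)`."

The case `k = 1` in this file: `GL(k,ℂ)^ ∋ λ = λ_n : c ↦ cⁿ` (`n ∈ ℤ`), `V_λ = ℂ`, and
`P(xc, yc⁻¹) = c^{|α|−|β|} P` on a monomial `x^α y^β`, so `ℂ[X](λ_n)` is the span of the monomials of
WEIGHT `|α| − |β| = −n`; we index the pieces by that weight `d = −n` (`piece d`, Mathlib's
`weightedHomogeneousSubmodule` for the weight `x_i ↦ 1, y_j ↦ −1`).  Lemma (5.3) and Corollary (5.4)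
are proved here for `k = 1` and any field, by the factorisation `x^α y^β = (x_i y_j)·x^{α−e_i} y^{β−e_j}`
(`xty_mul_harmonics_eq_top`, `piece_eq_xty_mul_harmonicPiece`).  The companion file
`….KashiwaraVergne1978.PluriharmonicWeights` proves that for `k = 1` (characteristic `0`) the
pluriharmonic polynomials are exactly `K[x] + K[y]` and transcribes the torus part / the differential
of `τ(λ)` of (5.5).

The HodgeConjecture (PerL) cell uses `(ιx, ιy) = (Fin 2, Unit)`, `K = ℂ`: then
`MvPolynomial (Fin 2 ⊕ Unit) ℂ` is literally its carrier `ℂ[z₁, z₂, w]` of the pair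
`(U(2,1), U(1))`, `kvDelta i ()` its lowering operators `∂_{z_i}∂_w`, `kvXtY i ()` its raising operators
`z_i w ·`, and `piece d` its `U(1)`-grading; the comparison with that cell's oscillator operators is a
summit-side file, not part of the literature.

NOT here: general `k ≥ 1` (matrix variables; TODO), the `V_λ`-valued version, Prop. (5.6)
(irreducibility of `τ(λ)`), §§6–8 (highest weights, `L_k(λ)`, discrete series).

## References
* M. Kashiwara, M. Vergne, Invent. Math. 44 (1978) 1–47, Ch. III (5.1)–(5.6), pp. 41–42.
  [KashiwaraVergne1978]
-/

-- TODO(general form): k ≥ 1, i.e. variables `(ιx ⊕ ιy) × Fin k` and `Δ_{ij} = Σ_ν ∂²/∂x_{iν}∂y_{jν}`.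

namespace Literature.RepresentationTheory.KashiwaraVergne1978

open _root_.MvPolynomial _root_.Finsupp

open scoped BigOperators

namespace KVPoly

variable {K : Type*} [Field K] {ιx ιy : Type*}

/-! ## §0. Two computations with monomials -/

/-- For any rescaling `v ↦ c_v · X_v` of the variables, `aeval` multiplies the monomial `X^m` by
`∏_v c_v^{m_v}` (used for the `GL(1)`-twist of (5.2) and the torus of (5.5)).
[cite: KashiwaraVergne1978, III (5.2), p. 42] -/
theorem aeval_smul_X_monomial {σ : Type*} (cv : σ → K) (m : σ →₀ ℕ) (r : K) :
    aeval (fun v => cv v • (X v : MvPolynomial σ K)) (monomial m r) =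
      (m.prod fun v e => cv v ^ e) • monomial m r := by
  rw [aeval_monomial, algebraMap_eq, smul_eq_C_mul]
  have h : (m.prod fun v e => (cv v • (X v : MvPolynomial σ K)) ^ e) =
      C (m.prod fun v e => cv v ^ e) * m.prod fun v e => (X v : MvPolynomial σ K) ^ e := by
    rw [map_finsuppProd, ← Finsupp.prod_mul]
    refine Finsupp.prod_congr fun v _ => ?_
    rw [smul_eq_C_mul, mul_pow, ← map_pow]
  rw [h, monomial_eq, ← mul_assoc, ← mul_assoc, mul_comm (C r)]

/-- Over finite index types the product `∏_v c_v^{m_v}` over `ιx ⊕ ιy` splits into the `x`- and the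
`y`-part. [cite: KashiwaraVergne1978, III (5.2), p. 42] -/
theorem prod_pow_sum_elim [Fintype ιx] [Fintype ιy] (f : ιx → K) (g : ιy → K)
    (m : ιx ⊕ ιy →₀ ℕ) :
    (m.prod fun v e => Sum.elim f g v ^ e) =
      (∏ i, f i ^ m (Sum.inl i)) * ∏ j, g j ^ m (Sum.inr j) := by
  rw [Finsupp.prod_fintype _ _ (fun v => pow_zero (Sum.elim f g v))]
  simp only [Fintype.prod_sum_type, Sum.elim_inl, Sum.elim_inr]

/-! ## §1. (5.1): the operators `Δ_{ij}` and the pluriharmonic polynomials `𝔥` (`k = 1`) -/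

/-- **KV78 III (5.1)**, `k = 1`: `Δ_{i,j} = ∂²/∂x_i ∂y_j` on `K[x_i, y_j : i ∈ ιx, j ∈ ιy]`
(`x_i = X (inl i)`, `y_j = X (inr j)`). [cite: KashiwaraVergne1978, III (5.1), p. 41] -/
noncomputable def kvDelta (i : ιx) (j : ιy) :
    MvPolynomial (ιx ⊕ ιy) K →ₗ[K] MvPolynomial (ιx ⊕ ιy) K where
  toFun f := pderiv (Sum.inl i) (pderiv (Sum.inr j) f)
  map_add' f g := by simp only [map_add]
  map_smul' r f := by simp only [Derivation.map_smul, RingHom.id_apply]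

/-- Unfolding of `kvDelta`. [cite: KashiwaraVergne1978, III (5.1), p. 41] -/
theorem kvDelta_apply (i : ιx) (j : ιy) (f : MvPolynomial (ιx ⊕ ιy) K) :
    kvDelta i j f = pderiv (Sum.inl i) (pderiv (Sum.inr j) f) := rfl

/-- "We shall call a solution of this system pluriharmonic" — `Δ_{ij} f = 0` for all `i, j`.
[cite: KashiwaraVergne1978, III (5.1), p. 41] -/
def IsPluriharmonic (f : MvPolynomial (ιx ⊕ ιy) K) : Prop := ∀ i j, kvDelta i j f = 0

/-- "We denote by `𝔥` the space of all pluriharmonic polynomials" — as a `K`-submodule (the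
intersection of the kernels of the `Δ_{ij}`). [cite: KashiwaraVergne1978, III (5.1), p. 41] -/
noncomputable def harmonics : Submodule K (MvPolynomial (ιx ⊕ ιy) K) :=
  ⨅ i : ιx, ⨅ j : ιy, LinearMap.ker (kvDelta (K := K) i j)

/-- Membership in `𝔥` is pluriharmonicity. [cite: KashiwaraVergne1978, III (5.1), p. 41] -/
theorem mem_harmonics_iff (f : MvPolynomial (ιx ⊕ ιy) K) :
    f ∈ harmonics ↔ IsPluriharmonic f := by
  simp only [harmonics, Submodule.mem_iInf, LinearMap.mem_ker, IsPluriharmonic]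

/-! ## §2. (5.2): `ℂ[xᵗy]`, the `GL(1)`-twist `P ↦ P(xc, yc⁻¹)` and the pieces `ℂ[X](λ)` -/

/-- **KV78 III (5.2)**, `k = 1`: `ℂ[xᵗy]` = the subalgebra generated by the `(xᵗy)_{i,j} = x_i y_j`
("the subspace of `ℂ[X]` generated by `(xᵗy)_{i,j}`", used multiplicatively in `ℂ[xᵗy]𝔥`).
[cite: KashiwaraVergne1978, III (5.2), pp. 41–42] -/
noncomputable def xty : Subalgebra K (MvPolynomial (ιx ⊕ ιy) K) :=
  Algebra.adjoin K (Set.range fun ij : ιx × ιy =>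
    (X (Sum.inl ij.1) : MvPolynomial (ιx ⊕ ιy) K) * X (Sum.inr ij.2))

/-- **KV78 III (5.2)**: multiplication by the generator `(xᵗy)_{i,j} = x_i y_j` of `ℂ[xᵗy]`, as a
linear operator on `ℂ[X]`. [cite: KashiwaraVergne1978, III (5.2), p. 41] -/
noncomputable def kvXtY (i : ιx) (j : ιy) :
    MvPolynomial (ιx ⊕ ιy) K →ₗ[K] MvPolynomial (ιx ⊕ ιy) K :=
  LinearMap.mulLeft K ((X (Sum.inl i) : MvPolynomial (ιx ⊕ ιy) K) * X (Sum.inr j))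

/-- Unfolding of `kvXtY`. [cite: KashiwaraVergne1978, III (5.2), p. 41] -/
theorem kvXtY_apply (i : ιx) (j : ιy) (f : MvPolynomial (ιx ⊕ ιy) K) :
    kvXtY i j f = X (Sum.inl i) * X (Sum.inr j) * f := rfl

/-- The generators `x_i y_j` lie in `ℂ[xᵗy]`. [cite: KashiwaraVergne1978, III (5.2), p. 41] -/
theorem X_mul_X_mem_xty (i : ιx) (j : ιy) :
    (X (Sum.inl i) : MvPolynomial (ιx ⊕ ιy) K) * X (Sum.inr j) ∈ xty :=
  Algebra.subset_adjoin ⟨(i, j), rfl⟩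

/-- The `GL(k) = GL(1)`-weight of a variable: `x_i ↦ 1`, `y_j ↦ −1`, so that a monomial `x^α y^β` has
weight `|α| − |β|` and `P(xc, yc⁻¹) = c^{weight} P` ((5.2) with `k = 1`).
[cite: KashiwaraVergne1978, III (5.2), p. 42] -/
def kvWeight : ιx ⊕ ιy → ℤ := Sum.elim (fun _ => 1) (fun _ => -1)

/-- `kvWeight` on an `x`-variable. [cite: KashiwaraVergne1978, III (5.2), p. 42] -/
@[simp] theorem kvWeight_inl (i : ιx) : kvWeight (Sum.inl i : ιx ⊕ ιy) = 1 := rfl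

/-- `kvWeight` on a `y`-variable. [cite: KashiwaraVergne1978, III (5.2), p. 42] -/
@[simp] theorem kvWeight_inr (j : ιy) : kvWeight (Sum.inr j : ιx ⊕ ιy) = -1 := rfl

/-- **KV78 III (5.2)**, `k = 1`: the piece `ℂ[X](λ_{−d})` = polynomials all of whose monomials
`x^α y^β` have `|α| − |β| = d` (Mathlib's weighted-homogeneous submodule for `kvWeight`).
[cite: KashiwaraVergne1978, III (5.2), p. 42] -/
noncomputable def piece (d : ℤ) : Submodule K (MvPolynomial (ιx ⊕ ιy) K) :=
  weightedHomogeneousSubmodule K kvWeight d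

/-- Membership in a piece. [cite: KashiwaraVergne1978, III (5.2), p. 42] -/
theorem mem_piece_iff (d : ℤ) (f : MvPolynomial (ιx ⊕ ιy) K) :
    f ∈ piece d ↔ IsWeightedHomogeneous kvWeight f d := Iff.rfl

/-- A monomial lies in the piece of its weight. [cite: KashiwaraVergne1978, III (5.2), p. 42] -/
theorem monomial_mem_piece (m : ιx ⊕ ιy →₀ ℕ) (r : K) :
    monomial m r ∈ piece (K := K) (weight kvWeight m) :=
  isWeightedHomogeneous_monomial _ _ _ rfl

/-- The weight of `x_i y_j` is `0`. [cite: KashiwaraVergne1978, III (5.2), p. 42] -/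
theorem weight_single_inl_add_single_inr (i : ιx) (j : ιy) :
    weight kvWeight (single (Sum.inl i : ιx ⊕ ιy) 1 + single (Sum.inr j) 1) = (0 : ℤ) := by
  rw [map_add, weight_single, weight_single, kvWeight_inl, kvWeight_inr]
  simp

/-- The rescaling of (5.2), `k = 1`: `x_i ↦ c x_i`, `y_j ↦ c⁻¹ y_j`.
[cite: KashiwaraVergne1978, III (5.2), p. 42] -/
def uScale (c : Kˣ) : ιx ⊕ ιy → K := Sum.elim (fun _ => (c : K)) (fun _ => ((c⁻¹ : Kˣ) : K))

/-- **KV78 III (5.2)**, `k = 1`: the substitution `P ↦ P(xc, yᵗc⁻¹) = P(xc, yc⁻¹)`.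
[cite: KashiwaraVergne1978, III (5.2), p. 42; the action `(g₁,g₂,c)·(x,y) = (g₁xc⁻¹, ᵗg₂⁻¹yᵗc)` p. 41] -/
noncomputable def kvUTwist (c : Kˣ) : MvPolynomial (ιx ⊕ ιy) K →ₐ[K] MvPolynomial (ιx ⊕ ιy) K :=
  aeval fun v => uScale c v • (X v : MvPolynomial (ιx ⊕ ιy) K)

/-- On a monomial `x^α y^β`: `P(xc, yc⁻¹) = (∏_i c^{α_i}) (∏_j c^{−β_j}) · P`.
[cite: KashiwaraVergne1978, III (5.2), p. 42] -/
theorem kvUTwist_monomial [Fintype ιx] [Fintype ιy] (c : Kˣ) (m : ιx ⊕ ιy →₀ ℕ) (r : K) :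
    kvUTwist c (monomial m r) =
      ((∏ i, (c : K) ^ m (Sum.inl i)) * ∏ j, ((c⁻¹ : Kˣ) : K) ^ m (Sum.inr j)) • monomial m r := by
  rw [kvUTwist, aeval_smul_X_monomial]
  congr 1
  exact prod_pow_sum_elim _ _ m

/-- The weight of a monomial over finite index types: `|α| − |β|`.
[cite: KashiwaraVergne1978, III (5.2), p. 42] -/
theorem weight_kvWeight_eq [Fintype ιx] [Fintype ιy] (m : ιx ⊕ ιy →₀ ℕ) :
    weight kvWeight m = ((∑ i, m (Sum.inl i) : ℕ) : ℤ) - ((∑ j, m (Sum.inr j) : ℕ) : ℤ) := by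
  classical
  rw [weight_apply, Finsupp.sum_fintype _ _ (fun v => zero_smul ℕ (kvWeight v))]
  simp only [Fintype.sum_sum_type, kvWeight_inl, kvWeight_inr, Nat.cast_sum]
  rw [sub_eq_add_neg, ← Finset.sum_neg_distrib]
  congr 1 <;> refine Finset.sum_congr rfl fun v _ => ?_ <;> simp

/-- **KV's grading, `k = 1`**: on the piece `ℂ[X](λ_{−d})` the twist `P ↦ P(xc, yᵗc⁻¹)` acts by the
scalar `c^d` (`= λ_{−d}(c)⁻¹`). [cite: KashiwaraVergne1978, III (5.2), p. 42] -/
theorem kvUTwist_of_mem_piece [Fintype ιx] [Fintype ιy] (c : Kˣ) {d : ℤ}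
    {f : MvPolynomial (ιx ⊕ ιy) K} (hf : f ∈ piece d) :
    kvUTwist c f = ((c : K) ^ d) • f := by
  have hc : (c : K) ≠ 0 := c.ne_zero
  have key : ∀ m ∈ f.support, kvUTwist c (monomial m (coeff m f)) = ((c : K) ^ d) • monomial m (coeff m f) := by
    intro m hm
    have hw : weight kvWeight m = d := hf (MvPolynomial.mem_support_iff.mp hm)
    rw [kvUTwist_monomial, Finset.prod_pow_eq_pow_sum, Finset.prod_pow_eq_pow_sum, ← hw,
      weight_kvWeight_eq, Units.val_inv_eq_inv_val, inv_pow, ← zpow_natCast, ← zpow_natCast,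
      ← zpow_neg, ← zpow_add₀ hc, sub_eq_add_neg]
  conv_lhs => rw [f.as_sum]
  conv_rhs => rw [f.as_sum]
  rw [map_sum, Finset.smul_sum]
  exact Finset.sum_congr rfl key

/-! ## §3. Monomials free of `x` or free of `y` are pluriharmonic -/

/-- A monomial without `y`-variables is pluriharmonic (`∂/∂y_j` kills it).
[cite: KashiwaraVergne1978, III (5.1), p. 41] -/
theorem isPluriharmonic_monomial_of_inr (m : ιx ⊕ ιy →₀ ℕ) (r : K) (h : ∀ j, m (Sum.inr j) = 0) :
    IsPluriharmonic (monomial m r) := by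
  intro i j
  rw [kvDelta_apply, pderiv_monomial, h j, Nat.cast_zero, mul_zero, monomial_zero, map_zero]

/-- A monomial without `x`-variables is pluriharmonic (`∂/∂x_i` kills `∂/∂y_j` of it).
[cite: KashiwaraVergne1978, III (5.1), p. 41] -/
theorem isPluriharmonic_monomial_of_inl (m : ιx ⊕ ιy →₀ ℕ) (r : K) (h : ∀ i, m (Sum.inl i) = 0) :
    IsPluriharmonic (monomial m r) := by
  intro i j
  have h0 : ((m - single (Sum.inr j) 1 : ιx ⊕ ιy →₀ ℕ) : ιx ⊕ ιy → ℕ) (Sum.inl i) = 0 := by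
    rw [Finsupp.tsub_apply, h i, single_eq_of_ne Sum.inl_ne_inr, tsub_zero]
  rw [kvDelta_apply, pderiv_monomial, pderiv_monomial, h0, Nat.cast_zero, mul_zero, monomial_zero]

/-- A polynomial each of whose monomials is free of `x` or free of `y` is pluriharmonic (no
hypothesis on `K`). [cite: KashiwaraVergne1978, III (5.1), p. 41] -/
theorem IsPluriharmonic.of_support {f : MvPolynomial (ιx ⊕ ιy) K}
    (h : ∀ m ∈ f.support, (∀ i, m (Sum.inl i) = 0) ∨ (∀ j, m (Sum.inr j) = 0)) :
    IsPluriharmonic f := by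
  intro i j
  rw [f.as_sum, map_sum]
  refine Finset.sum_eq_zero fun m hm => ?_
  rcases h m hm with hx | hy
  · exact isPluriharmonic_monomial_of_inl m _ hx i j
  · exact isPluriharmonic_monomial_of_inr m _ hy i j

/-! ## §4. Lemma (5.3) `ℂ[X] = ℂ[xᵗy]𝔥` and Corollary (5.4) `ℂ[X](λ) = ℂ[xᵗy]𝔥(λ)` (`k = 1`) -/

/-- The factorisation behind (5.3)/(5.4) for `k = 1`: every monomial `x^α y^β` is a product of some
`x_i y_j`'s and a monomial free of `x` or free of `y` (hence pluriharmonic), of the same weight: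
`monomial m r ∈ ℂ[xᵗy] · (𝔥 ∩ ℂ[X](λ))` with `λ` the weight of `m`.
[cite: KashiwaraVergne1978, III Lemma (5.3), Cor. (5.4), p. 42] -/
theorem monomial_mem_xty_mul_harmonicPiece (m : ιx ⊕ ιy →₀ ℕ) (r : K) :
    monomial m r ∈ Subalgebra.toSubmodule xty * (harmonics ⊓ piece (K := K) (weight kvWeight m)) := by
  suffices h : ∀ (n : ℕ) (m : ιx ⊕ ιy →₀ ℕ), m.degree = n →
      monomial m r ∈ Subalgebra.toSubmodule xty * (harmonics ⊓ piece (K := K) (weight kvWeight m)) from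
    h _ m rfl
  intro n
  induction n using Nat.strong_induction_on with
  | _ n ih =>
    intro m hm
    by_cases hx : ∀ i, m (Sum.inl i) = 0
    · rw [← one_mul (monomial m r)]
      exact Submodule.mul_mem_mul (Subalgebra.one_mem _)
        ⟨(mem_harmonics_iff _).2 (isPluriharmonic_monomial_of_inl m r hx), monomial_mem_piece m r⟩
    by_cases hy : ∀ j, m (Sum.inr j) = 0
    · rw [← one_mul (monomial m r)]
      exact Submodule.mul_mem_mul (Subalgebra.one_mem _)
        ⟨(mem_harmonics_iff _).2 (isPluriharmonic_monomial_of_inr m r hy), monomial_mem_piece m r⟩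
    obtain ⟨i, hi⟩ := not_forall.mp hx
    obtain ⟨j, hj⟩ := not_forall.mp hy
    -- peel off `x_i y_j`: `m = m' + (e_i + e_j)`
    set m' : ιx ⊕ ιy →₀ ℕ := m - single (Sum.inl i) 1 - single (Sum.inr j) 1 with hm'
    have hj' : ((m - single (Sum.inl i) 1 : ιx ⊕ ιy →₀ ℕ) : ιx ⊕ ιy → ℕ) (Sum.inr j) ≠ 0 := by
      rwa [Finsupp.tsub_apply, single_eq_of_ne Sum.inr_ne_inl, tsub_zero]
    have hdec : m = single (Sum.inl i : ιx ⊕ ιy) 1 + single (Sum.inr j) 1 + m' := by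
      rw [hm', add_assoc, add_comm (single (Sum.inr j) 1), sub_add_single_one_cancel hj',
        add_comm, sub_add_single_one_cancel hi]
    have hdeg : m'.degree < n := by
      rw [← hm, hdec, map_add, map_add, degree_single, degree_single]
      omega
    have hwt : weight kvWeight m' = weight kvWeight m := by
      rw [hdec, map_add, weight_single_inl_add_single_inr, zero_add]
    have hfac : monomial m r =
        ((X (Sum.inl i) : MvPolynomial (ιx ⊕ ιy) K) * X (Sum.inr j)) * monomial m' r := by
      rw [X, X, monomial_mul, monomial_mul, one_mul, one_mul, ← hdec]
    have hmem := Submodule.mul_mem_mul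
      (show (X (Sum.inl i) : MvPolynomial (ιx ⊕ ιy) K) * X (Sum.inr j) ∈ Subalgebra.toSubmodule xty from
        X_mul_X_mem_xty (K := K) i j) (ih _ hdeg m' rfl)
    rw [← mul_assoc, (Subalgebra.isIdempotentElem_toSubmodule xty).eq, hwt, ← hfac] at hmem
    exact hmem

/-- **KV78 III Lemma (5.3)**, `k = 1`: `ℂ[X] = ℂ[xᵗy]·𝔥` — every polynomial is a sum of products
of an element of the algebra generated by the `x_i y_j` with a pluriharmonic polynomial.  No
hypothesis on the field. [cite: KashiwaraVergne1978, III Lemma (5.3), p. 42] -/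
theorem xty_mul_harmonics_eq_top :
    Subalgebra.toSubmodule xty * harmonics = (⊤ : Submodule K (MvPolynomial (ιx ⊕ ιy) K)) := by
  refine eq_top_iff.2 fun f _ => ?_
  rw [f.as_sum]
  refine Submodule.sum_mem _ fun m _ => ?_
  exact mul_le_mul' (le_refl (Subalgebra.toSubmodule xty)) inf_le_left
    (monomial_mem_xty_mul_harmonicPiece m _)

/-- `x_i y_j` has weight `0`. [cite: KashiwaraVergne1978, III (5.2), p. 42] -/
theorem X_mul_X_mem_piece_zero (i : ιx) (j : ιy) :
    (X (Sum.inl i) : MvPolynomial (ιx ⊕ ιy) K) * X (Sum.inr j) ∈ piece (K := K) 0 := by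
  have h := monomial_mem_piece (K := K) (single (Sum.inl i : ιx ⊕ ιy) 1 + single (Sum.inr j) 1) 1
  rwa [weight_single_inl_add_single_inr, ← one_mul (1 : K), ← monomial_mul] at h

/-- The weight-`0` piece `ℂ[X](λ₀)` is a subalgebra (it contains `ℂ[xᵗy]`, next lemma).
[cite: KashiwaraVergne1978, III (5.2), p. 42] -/
noncomputable def pieceZero : Subalgebra K (MvPolynomial (ιx ⊕ ιy) K) :=
  { piece (K := K) (ιx := ιx) (ιy := ιy) 0 with
    mul_mem' := fun {a b} ha hb => by
      have h := weightedHomogeneousSubmodule_mul kvWeight (0 : ℤ) 0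
        (Submodule.mul_mem_mul (show a ∈ piece (K := K) 0 from ha) (show b ∈ piece (K := K) 0 from hb))
      rw [add_zero] at h
      exact h
    algebraMap_mem' := fun r =>
      show IsWeightedHomogeneous kvWeight (algebraMap K (MvPolynomial (ιx ⊕ ιy) K) r) (0 : ℤ) from
        isWeightedHomogeneous_C kvWeight r }

/-- Membership in `pieceZero` is membership in the weight-`0` piece.
[cite: KashiwaraVergne1978, III (5.2), p. 42] -/
theorem mem_pieceZero_iff (f : MvPolynomial (ιx ⊕ ιy) K) : f ∈ pieceZero ↔ f ∈ piece (K := K) 0 :=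
  Iff.rfl

/-- `ℂ[xᵗy] ⊆ ℂ[X](λ₀)`: the algebra generated by the `x_i y_j` consists of weight-`0` polynomials.
[cite: KashiwaraVergne1978, III (5.2), p. 42] -/
theorem xty_le_pieceZero : (xty : Subalgebra K (MvPolynomial (ιx ⊕ ιy) K)) ≤ pieceZero :=
  Algebra.adjoin_le (by rintro _ ⟨⟨i, j⟩, rfl⟩; exact X_mul_X_mem_piece_zero i j)

/-- **KV78 III Corollary (5.4)**, `k = 1`: `ℂ[X](λ) = ℂ[xᵗy]·𝔥(λ)` for every piece.
[cite: KashiwaraVergne1978, III Cor. (5.4), p. 42] -/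
theorem piece_eq_xty_mul_harmonicPiece (d : ℤ) :
    piece (K := K) d = Subalgebra.toSubmodule xty * (harmonics ⊓ piece (K := K) (ιx := ιx) (ιy := ιy) d) := by
  apply le_antisymm
  · intro f hf
    rw [f.as_sum]
    refine Submodule.sum_mem _ fun m hm => ?_
    have hw : weight kvWeight m = d := hf (MvPolynomial.mem_support_iff.mp hm)
    rw [← hw]
    exact monomial_mem_xty_mul_harmonicPiece m _
  · rw [Submodule.mul_le]
    intro a ha b hb
    have h := weightedHomogeneousSubmodule_mul kvWeight (0 : ℤ) d
      (Submodule.mul_mem_mul (show a ∈ piece (K := K) 0 from xty_le_pieceZero ha) hb.2)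
    rwa [zero_add] at h

end KVPoly

end Literature.RepresentationTheory.KashiwaraVergne1978
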